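import Summits.BirchSwinnertonDyer.Rank1Residual.Additive.CyclotomicTowerSignedSelmer
import Summits.BirchSwinnertonDyer.Rank1Residual.Additive.CyclotomicTowerLocalTorsionPadic
import Summits.BirchSwinnertonDyer.Rank1Residual.Additive.PadicClosureCyclotomicGalois
import Literature.NumberTheory.EllipticCurves.CyclotomicZpExtension
import Literature.NumberTheory.EllipticCurves.Kato2004.SemilocalDecompositionProofs
import Literature.NumberTheory.GaloisRepresentations.AbsGaloisRestrictCyclotomic
import HarnessLib

/-!
# F9, the identification of the LOCAL tower: for the cyclotomic `ℤ_p`-extension `κ` and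
# `K₀ ⊇ μ_p` of degree `≤ p − 1`, the local subgroup of `Gal(K̄/K₀·K_n^κ)` at `ι : K̄ → ℚ̄_p` IS the
# stabiliser of `ζ_{p^{n+1}}` — `(towerSubgroup κ K₀ n)_{ℚ_p} = Stab(ζ_{p^{n+1}})`, i.e.
# `K_{n,v} = ℚ_p(ζ_{p^{n+1}})` (cell `b2b-bsdres`, CLASS-CLOSURE lane, class O10 — x1b GEN 34, class
# lead; file 39 of the local series: the hypothesis `hU` of files 36–38 for cc-typer-6's tower)

HONEST FRAMING (cell `b2b-bsdres`, run/shared/lean/b2b/bsd-rank1-residual/, verbatim in every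
file): the goal of the cell is to DELETE the COMBINATION-SHAPED residual classes of the
Birch–Swinnerton-Dyer formula for ALL analytic-rank `≤ 1` elliptic curves over `ℚ` — "full BSD
formula for every rank `≤ 1` curve in class `C`" assembled STRICTLY from published theorems — so
that the rank-`≤ 1` remainder becomes exactly the CONSTRUCTION-SHAPED classes, which are TYPED
(missing-input `Prop`s), NOT attempted. This is not "finishing BSD". CLASS-CLOSURE lane: prove
what is provable now; shrink each hard class to its core with data; no claim beyond stated classes;
research routes on CONSTRUCTION-SHAPED X12 / O10; census / instrument output = EVIDENCE / conjecture
items, NEVER a Literature fact; `RESIDUAL-MAP.md` marks change only by signed lines. THIS FILE: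
TOOL THEOREMS ONLY — no definition, no named Literature fact, no Summits-side fact `def … : Prop`,
no `sorry`, axioms standard; nothing is booked; no label / mark / count / sub-cell moves; O10 stays
OPEN / CONSTRUCTION-SHAPED; nothing about `BSD(W, p)` of any pair is claimed.

## Content (`K` a number field with `K → ℚ_p`, `κ : ZpExtension K p` CYCLOTOMIC
## (`ker κ = χ_p⁻¹(μ(ℤ_p))`), `K₀/K` a number field containing a primitive `p`-th root of unity with
## `[Γ_K : Gal(K̄/K₀)]` prime to `p` resp. `≤ p − 1`, `p` odd, `ι : K̄ → ℚ̄_p`)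

* §1 **No `p`-torsion in `1 + pℤ_p`** (`p` odd): a unit of finite order `≡ 1 (mod p)` is `1`
  (the tree's `ℓ` with `ker ℓ = μ(ℤ_p) = μ_{p−1}`, file CyclotomicZpExtension, and
  `Kato2004.eq_one_of_pow_sub_one_eq_one_of_toZMod_eq_one`).
* §2 GLOBAL: `κ(Gal(K̄/K₀)) = ℤ_p` (index prime to `p`); elements of `Gal(K̄/K₀)` fix `μ_p(K̄)`;
  `ρ ∈ Gal(K̄/K₀) ⟹ ρ^{pⁿ}` fixes `μ_{p^{n+1}}` (`χ(ρ) ≡ 1 (p) ⟹ χ(ρ)^{pⁿ} ≡ 1 (p^{n+1})`,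
  Mathlib `dvd_sub_pow_of_dvd_sub`); `k ∈ ker κ ∩ Gal(K̄/K₀) ⟹ χ(k) = 1 ⟹ k` fixes `μ_{p^∞}`; hence
  **`towerSubgroup κ K₀ n` fixes `μ_{p^{n+1}}(K̄)`** (`σ = ρ^{pⁿ}·k`).
* §3 LOCAL: `(towerSubgroup κ K₀ n)_{ℚ_p} ≤ Stab(ζ_{p^{n+1}})` (transport along `ι`), the index bound
  `[Γ_{ℚ_p} : (towerSubgroup κ K₀ n)_{ℚ_p}] ∣ pⁿ·[Γ_K : Gal(K̄/K₀)] ≤ φ(p^{n+1}) = [Γ_{ℚ_p} : Stab(ζ_{p^{n+1}})]`,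
  and **`localSubgroupOfEmb_towerSubgroup_eq_stab`**: EQUALITY — the hypothesis `hU` of
  `localFixedPointsOfEmb_le_sup_towerSigned` for cc-typer-6's tower; `_of_finrank_le` form.

References: [Kobayashi2003] §2 p. 4 (`K_n = ℚ(ζ_{p^{n+1}})`, `k_n = ℚ_p(ζ_{p^{n+1}})`);
[Washington1997] §13.1; [SerreLocalFields1979] Ch. IV §4; [NeukirchANT1999] Ch. IV §1.
-/

noncomputable section

open scoped Classical

namespace Summit.BirchSwinnertonDyer.Rank1Residual.Additive

open Literature.NumberTheory.EllipticCurves Literature.NumberTheory.GaloisRepresentations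
  Literature.NumberTheory.EllipticCurves.CyclotomicZp ZpExtension PadicCyclotomicTower Field

variable {p : ℕ} [hp : Fact p.Prime]

/-! ## §1 No `p`-torsion in `1 + pℤ_p` -/

/-- **A unit of `ℤ_p` of finite order which is `≡ 1 (mod p)` is `1`** (`p` odd): the torsion of
`ℤ_pˣ` is `μ_{p−1}` (`ker ℓ`, `ℓ` the normalised logarithm of file CyclotomicZpExtension, so
`u^{p−1} = 1`), and a `(p−1)`-th root of unity `≡ 1 (mod p)` is `1`. [cite: Washington1997, §13.1] -/
theorem eq_one_of_isOfFinOrder_of_toZMod_eq_one (hp2 : p ≠ 2) {u : ℤ_[p]ˣ} (hu : IsOfFinOrder u)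
    (h1 : PadicInt.toZMod (u : ℤ_[p]) = 1) : u = 1 := by
  have ht : ell p u = 0 := (ell_eq_zero_iff p u).mpr hu
  have hpow : (u : ℤ_[p]) ^ torsionOrder p = 1 := by
    have h := cycPow_torsionOrder_mul_ell p u
    rw [ht, mul_zero, AddChar.map_zero_eq_one] at h
    exact h.symm
  have htor : torsionOrder p = p - 1 := by
    unfold torsionOrder cyclotomicExponent
    rw [if_neg hp2, pow_one, Nat.totient_prime hp.out]
  rw [htor] at hpow
  exact Units.ext (Kato2004.eq_one_of_pow_sub_one_eq_one_of_toZMod_eq_one p hpow h1)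

/-- `ζ^a = ζ^b ↔ a ≡ b (mod k)` for a primitive `k`-th root of unity `ζ` (`k ≠ 0`) in a
commutative monoid (through the unit group, Mathlib `pow_eq_pow_iff_modEq`). [folklore] -/
theorem pow_eq_pow_iff_modEq_of_isPrimitiveRoot {M : Type*} [CommMonoid M] {ζ : M} {k : ℕ}
    (hζ : IsPrimitiveRoot ζ k) (hk : k ≠ 0) {a b : ℕ} : ζ ^ a = ζ ^ b ↔ a ≡ b [MOD k] := by
  obtain ⟨u, rfl⟩ := hζ.isUnit hk
  rw [← Units.val_pow_eq_pow_val, ← Units.val_pow_eq_pow_val, Units.val_inj, pow_eq_pow_iff_modEq,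
    ← (IsPrimitiveRoot.coe_units_iff.mp hζ).eq_orderOf]

/-! ## §2 GLOBAL: `towerSubgroup κ K₀ n` fixes the `p^{n+1}`-th roots of unity -/

section Global

variable {K : Type} [Field K] [NumberField K] (κ : ZpExtension K p)
  (K₀ : Type) [Field K₀] [NumberField K₀] [Algebra K K₀]

omit [NumberField K] [NumberField K₀] in
/-- **`κ(Gal(K̄/K₀)) = ℤ_p`** when `[Γ_K : Gal(K̄/K₀)]` is prime to `p`: the image has index dividing
that index, and a subgroup of `ℤ_p` of index `d` prime to `p` is everything (`d` is a unit).
[cite: Washington1997, §13.1] -/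
theorem exists_mem_galRange_apply_eq (hidx : ¬ p ∣ (galRange (K := K) K₀).index) (a : ℤ_[p]) :
    ∃ ρ ∈ galRange (K := K) K₀, κ ρ = Multiplicative.ofAdd a := by
  set S : Subgroup (Multiplicative ℤ_[p]) := (galRange (K := K) K₀).map κ.toContinuousMonoidHom.toMonoidHom
    with hS
  have hdvd : S.index ∣ (galRange (K := K) K₀).index := Subgroup.index_map_dvd _ κ.surjective
  have hSp : ¬ p ∣ S.index := fun h => hidx (h.trans hdvd)
  -- `S.index` is a unit of `ℤ_p`
  have hunit : IsUnit ((S.index : ℕ) : ℤ_[p]) := by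
    rw [PadicInt.isUnit_iff, PadicInt.norm_natCast_eq_one_iff]
    exact (Nat.Prime.coprime_iff_not_dvd hp.out).mpr hSp
  obtain ⟨t, ht⟩ := hunit
  have hmem : Multiplicative.ofAdd a ∈ S := by
    have h := Subgroup.pow_index_mem S (Multiplicative.ofAdd ((↑t⁻¹ : ℤ_[p]) * a))
    rwa [← ofAdd_nsmul, nsmul_eq_mul, ← ht, ← mul_assoc, Units.mul_inv, one_mul] at h
  obtain ⟨ρ, hρ, hρa⟩ := Subgroup.mem_map.mp hmem
  exact ⟨ρ, hρ, hρa⟩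

/-- **Elements of `Gal(K̄/K₀)` fix the `p`-th roots of unity of `K̄`** when `K₀` contains a primitive
`p`-th root of unity `z` (its image `j(z) ∈ K̄` is fixed, and every `p`-th root of unity is a power
of it). [cite: Kobayashi2003, §2 p. 4 (K₀ = ℚ(μ_p))] -/
theorem smul_eq_self_of_mem_galRange_of_pow_eq_one (hz : ∃ z : K₀, IsPrimitiveRoot z p)
    {σ : Field.absoluteGaloisGroup K} (hσ : σ ∈ galRange (K := K) K₀) {t : AlgebraicClosure K}
    (ht : t ^ p = 1) : σ • t = t := by
  obtain ⟨z, hzp⟩ := hz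
  have hζ : IsPrimitiveRoot (embIntoClosure (K := K) K₀ z) p :=
    hzp.map_of_injective (embIntoClosure (K := K) K₀).injective
  obtain ⟨i, -, rfl⟩ := hζ.eq_pow_of_pow_eq_one ht
  rw [smul_pow']
  congr 1
  exact smul_embIntoClosure_of_mem_galRange K₀ hσ z

/-- **`ρ ∈ Gal(K̄/K₀) ⟹ ρ^{pⁿ}` fixes every `p^{n+1}`-th root of unity** (`K₀ ⊇ μ_p`): `ρ` acts on
`μ_{p^{n+1}}` by `χ(ρ) ≡ 1 (mod p)` (it fixes `ζ^{pⁿ} ∈ μ_p`), and `c ≡ 1 (mod p) ⟹ c^{pⁿ} ≡ 1 (mod p^{n+1})`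
(Mathlib `dvd_sub_pow_of_dvd_sub`). [cite: Washington1997, §13.1] -/
theorem pow_smul_eq_self_of_mem_galRange (hz : ∃ z : K₀, IsPrimitiveRoot z p)
    {ρ : Field.absoluteGaloisGroup K} (hρ : ρ ∈ galRange (K := K) K₀) (n : ℕ)
    {ζ : AlgebraicClosure K} (hζ : IsPrimitiveRoot ζ (p ^ (n + 1))) : ρ ^ p ^ n • ζ = ζ := by
  set c : ℕ := ((GaloisRep.cyclotomicCharacter K p ρ).val.toZModPow (n + 1)).val with hc
  have hρζ : ρ • ζ = ζ ^ c := GaloisRep.cyclotomicCharacter_spec K p ρ ζ hζ.pow_eq_one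
  -- `ρ^j • ζ = ζ^(c^j)`
  have hiter : ∀ j : ℕ, ρ ^ j • ζ = ζ ^ c ^ j := by
    intro j
    induction j with
    | zero => rw [pow_zero, one_smul, pow_zero, pow_one]
    | succ j ih => rw [pow_succ, mul_smul, hρζ, smul_pow', ih, ← pow_mul, ← pow_succ]
  rw [hiter]
  -- `c ≡ 1 (mod p)`: `ρ` fixes the primitive `p`-th root `ζ^{pⁿ}`
  have hζp : IsPrimitiveRoot (ζ ^ p ^ n) p := by
    have := hζ.pow_of_dvd (pow_ne_zero n hp.out.ne_zero) (pow_dvd_pow p (Nat.le_succ n))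
    rwa [pow_succ, Nat.mul_div_cancel_left p (pow_pos hp.out.pos n)] at this
  have hfix : ρ • ζ ^ p ^ n = ζ ^ p ^ n :=
    smul_eq_self_of_mem_galRange_of_pow_eq_one K₀ hz hρ hζp.pow_eq_one
  rw [smul_pow', hρζ, ← pow_mul, mul_comm, pow_mul] at hfix
  -- `(ζ^{pⁿ})^c = ζ^{pⁿ}` ⟹ `c ≡ 1 [MOD p]`
  have hc1 : c ≡ 1 [MOD p] := by
    have h : (ζ ^ p ^ n) ^ c = (ζ ^ p ^ n) ^ 1 := by rw [pow_one]; exact hfix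
    exact (pow_eq_pow_iff_modEq_of_isPrimitiveRoot hζp hp.out.ne_zero).mp h
  -- `c^{pⁿ} ≡ 1 [MOD p^{n+1}]`
  have hdvd : ((p ^ (n + 1) : ℕ) : ℤ) ∣ (c : ℤ) ^ p ^ n - 1 ^ p ^ n :=
    dvd_sub_pow_of_dvd_sub (R := ℤ) (p := p) (a := (c : ℤ)) (b := 1)
      (by have := (Nat.modEq_iff_dvd.mp hc1.symm); simpa using this) n
  have hmod : c ^ p ^ n ≡ 1 [MOD p ^ (n + 1)] := by
    refine (Nat.modEq_iff_dvd.mpr ?_).symm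
    push_cast
    rw [one_pow] at hdvd
    exact hdvd
  have h : ζ ^ c ^ p ^ n = ζ ^ 1 :=
    (pow_eq_pow_iff_modEq_of_isPrimitiveRoot hζ (pow_ne_zero _ hp.out.ne_zero)).mpr hmod
  rw [h, pow_one]

variable {κ} in
/-- **`k ∈ ker κ ∩ Gal(K̄/K₀)` fixes every `p`-power root of unity** (`κ` cyclotomic, `K₀ ⊇ μ_p`,
`p` odd): `χ(k)` has finite order (`ker κ = χ⁻¹(μ(ℤ_p))`) and is `≡ 1 (mod p)` (`k` fixes `μ_p`), so
`χ(k) = 1` (§1). [cite: Washington1997, §13.1] -/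
theorem smul_eq_self_of_mem_kerSubgroup_of_mem_galRange (hp2 : p ≠ 2) (hκ : κ.IsCyclotomic)
    (hz : ∃ z : K₀, IsPrimitiveRoot z p) {k : Field.absoluteGaloisGroup K} (hk : k ∈ κ.kerSubgroup)
    (hk₀ : k ∈ galRange (K := K) K₀) {m : ℕ} {ζ : AlgebraicClosure K} (hζ : ζ ^ p ^ m = 1) : k • ζ = ζ := by
  -- `χ(k)` is torsion
  have htor : IsOfFinOrder (GaloisRep.cyclotomicCharacter K p k) := by
    rw [show κ.kerSubgroup = _ from hκ, Subgroup.mem_comap, CommGroup.mem_torsion] at hk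
    exact hk
  -- `χ(k) ≡ 1 (mod p)`: `k` fixes a primitive `p`-th root of unity
  haveI : NeZero ((p : ℕ) : AlgebraicClosure K) := ⟨by exact_mod_cast hp.out.ne_zero⟩
  obtain ⟨t, ht⟩ := HasEnoughRootsOfUnity.exists_primitiveRoot (AlgebraicClosure K) p
  have hkt : k • t = t := smul_eq_self_of_mem_galRange_of_pow_eq_one K₀ hz hk₀ ht.pow_eq_one
  have hspec := GaloisRep.cyclotomicCharacter_spec K p (k := 1) k t (by rw [pow_one]; exact ht.pow_eq_one)
  rw [hkt] at hspec
  have h1 : PadicInt.toZMod ((GaloisRep.cyclotomicCharacter K p k : ℤ_[p]ˣ) : ℤ_[p]) = 1 := by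
    set x : ZMod (p ^ 1) := (GaloisRep.cyclotomicCharacter K p k).val.toZModPow 1 with hx
    have hmod : 1 ≡ x.val [MOD p] := by
      have h : t ^ 1 = t ^ x.val := by rw [pow_one]; exact hspec
      exact (pow_eq_pow_iff_modEq_of_isPrimitiveRoot ht hp.out.ne_zero).mp h
    have hlt : x.val < p := lt_of_lt_of_eq (ZMod.val_lt x) (pow_one p)
    have hxval : x.val = 1 := by
      have h : 1 % p = x.val % p := hmod
      rwa [Nat.mod_eq_of_lt hp.out.one_lt, Nat.mod_eq_of_lt hlt, eq_comm] at h
    haveI : NeZero (p ^ 1) := ⟨pow_ne_zero 1 hp.out.ne_zero⟩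
    haveI : Fact (1 < p ^ 1) := ⟨lt_of_lt_of_eq hp.out.one_lt (pow_one p).symm⟩
    have hval : x = 1 := ZMod.val_injective (p ^ 1) (by rw [hxval, ZMod.val_one])
    -- `ker (toZModPow 1) = pℤ_p = ker toZMod`
    have hker : ((GaloisRep.cyclotomicCharacter K p k : ℤ_[p]ˣ) : ℤ_[p]) - 1 ∈ RingHom.ker (PadicInt.toZModPow 1) := by
      rw [RingHom.mem_ker, map_sub, map_one, ← hx, hval, sub_self]
    rw [PadicInt.ker_toZModPow, pow_one, ← PadicInt.maximalIdeal_eq_span_p, ← PadicInt.ker_toZMod,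
      RingHom.mem_ker, map_sub, map_one, sub_eq_zero] at hker
    exact hker
  have hχ : GaloisRep.cyclotomicCharacter K p k = 1 := eq_one_of_isOfFinOrder_of_toZMod_eq_one hp2 htor h1
  have h := GaloisRep.cyclotomicCharacter_spec K p (k := m) k ζ hζ
  rw [hχ, Units.val_one, map_one] at h
  rcases Nat.eq_zero_or_pos m with rfl | hm
  · rw [pow_zero, pow_one] at hζ; rw [hζ, smul_one]
  · haveI : Fact (1 < p ^ m) := ⟨Nat.one_lt_pow hm.ne' hp.out.one_lt⟩
    rwa [ZMod.val_one, pow_one] at h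

variable {κ} in
/-- **`Gal(K̄/K₀·K_n^κ)` fixes `μ_{p^{n+1}}(K̄)`** — i.e. `K₀·K_n^κ ⊇ K(ζ_{p^{n+1}})` — for `κ`
cyclotomic, `K₀ ⊇ μ_p` with `[Γ_K : Gal(K̄/K₀)]` prime to `p`, `p` odd: `σ ∈ κ⁻¹(pⁿℤ_p) ∩ Gal(K̄/K₀)`
is `ρ^{pⁿ}·k` with `ρ ∈ Gal(K̄/K₀)` (`κ(Gal(K̄/K₀)) = ℤ_p`) and `k ∈ ker κ ∩ Gal(K̄/K₀)`.
[cite: Kobayashi2003, §2 p. 4 (K_n = ℚ(ζ_{p^{n+1}}))] [cite: Washington1997, §13.1] -/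
theorem smul_eq_self_of_mem_towerSubgroup (hp2 : p ≠ 2) (hκ : κ.IsCyclotomic)
    (hz : ∃ z : K₀, IsPrimitiveRoot z p) (hidx : ¬ p ∣ (galRange (K := K) K₀).index) {n : ℕ}
    {σ : Field.absoluteGaloisGroup K} (hσ : σ ∈ towerSubgroup κ K₀ n)
    {ζ : AlgebraicClosure K} (hζ : ζ ^ p ^ (n + 1) = 1) : σ • ζ = ζ := by
  rw [mem_towerSubgroup_iff, mem_layerSubgroup] at hσ
  obtain ⟨⟨a, ha⟩, hσ₀⟩ := hσ
  obtain ⟨ρ, hρ₀, hρa⟩ := exists_mem_galRange_apply_eq κ K₀ hidx a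
  -- `k = (ρ^{pⁿ})⁻¹ σ ∈ ker κ ∩ Gal(K̄/K₀)`
  set k : Field.absoluteGaloisGroup K := (ρ ^ p ^ n)⁻¹ * σ with hk
  have hkκ : k ∈ κ.kerSubgroup := by
    rw [mem_kerSubgroup, hk, map_mul, map_inv, map_pow, hρa, ← ofAdd_nsmul, nsmul_eq_mul, Nat.cast_pow,
      ← ha, ofAdd_toAdd, inv_mul_cancel]
  have hk₀ : k ∈ galRange (K := K) K₀ :=
    (galRange (K := K) K₀).mul_mem ((galRange (K := K) K₀).inv_mem ((galRange (K := K) K₀).pow_mem hρ₀ _)) hσ₀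
  have hσk : σ = ρ ^ p ^ n * k := by rw [hk, mul_inv_cancel_left]
  -- a primitive `p^{n+1}`-th root `ζ₀`; `ζ` is a power of it
  haveI : NeZero ((p ^ (n + 1) : ℕ) : AlgebraicClosure K) := ⟨by exact_mod_cast pow_ne_zero (n + 1) hp.out.ne_zero⟩
  obtain ⟨ζ₀, hζ₀⟩ := HasEnoughRootsOfUnity.exists_primitiveRoot (AlgebraicClosure K) (p ^ (n + 1))
  obtain ⟨i, -, rfl⟩ := hζ₀.eq_pow_of_pow_eq_one hζ
  rw [smul_pow', hσk, mul_smul, smul_eq_self_of_mem_kerSubgroup_of_mem_galRange K₀ hp2 hκ hz hkκ hk₀ hζ₀.pow_eq_one,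
    pow_smul_eq_self_of_mem_galRange K₀ hz hρ₀ n hζ₀]

end Global

/-! ## §3 LOCAL: `(towerSubgroup κ K₀ n)_{ℚ_p} = Stab(ζ_{p^{n+1}})` -/

section Local

variable {K : Type} [Field K] [NumberField K] [Algebra K ℚ_[p]] (κ : ZpExtension K p)
  (K₀ : Type) [Field K₀] [NumberField K₀] [Algebra K K₀]
  (ι : AlgebraicClosure K →ₐ[K] AlgebraicClosure ℚ_[p])

variable {κ} in
/-- **`(towerSubgroup κ K₀ n)_{ℚ_p} ≤ Stab(ζ_{p^{n+1}})`**: an element of `Γ_{ℚ_p}` restricting into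
`Gal(K̄/K₀·K_n^κ)` fixes `ι(ζ)` for a primitive `p^{n+1}`-th root `ζ ∈ K̄` (§2), hence the primitive
`p^{n+1}`-th root `zeta p (n+1) ∈ ℚ̄_p`. [cite: Kobayashi2003, §2 p. 4 (k_n = ℚ_p(ζ_{p^{n+1}}))] -/
theorem localSubgroupOfEmb_towerSubgroup_le_stab (hp2 : p ≠ 2) (hκ : κ.IsCyclotomic)
    (hz : ∃ z : K₀, IsPrimitiveRoot z p) (hidx : ¬ p ∣ (galRange (K := K) K₀).index) (n : ℕ) :
    localSubgroupOfEmb (towerSubgroup κ K₀ n) ι ≤ stab p (n + 1) := by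
  intro τ hτ
  rw [mem_localSubgroupOfEmb_iff] at hτ
  haveI : NeZero ((p ^ (n + 1) : ℕ) : AlgebraicClosure K) := ⟨by exact_mod_cast pow_ne_zero (n + 1) hp.out.ne_zero⟩
  haveI : NeZero (p ^ (n + 1)) := ⟨pow_ne_zero (n + 1) hp.out.ne_zero⟩
  obtain ⟨ζ, hζ⟩ := HasEnoughRootsOfUnity.exists_primitiveRoot (AlgebraicClosure K) (p ^ (n + 1))
  have hιζ : IsPrimitiveRoot (ι ζ) (p ^ (n + 1)) := hζ.map_of_injective ι.injective
  rw [mem_stab_iff, smul_eq_self_iff_of_isPrimitiveRoot (isPrimitiveRoot_zeta p (n + 1)) hιζ]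
  have hfix : resGalOfEmb ι τ • ζ = ζ := smul_eq_self_of_mem_towerSubgroup K₀ hp2 hκ hz hidx hτ hζ.pow_eq_one
  have h := apply_resGalAuxOfEmb_apply ι τ ζ
  rw [absoluteGaloisGroup.smul_def] at hfix ⊢
  change ι ((show AlgebraicClosure K ≃ₐ[K] AlgebraicClosure K from resGalOfEmb ι τ) ζ) = _ at h
  rw [show (absoluteGaloisGroup.toAlgEquiv K (resGalOfEmb ι τ)) ζ =
      (show AlgebraicClosure K ≃ₐ[K] AlgebraicClosure K from resGalOfEmb ι τ) ζ from rfl] at hfix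
  rw [hfix] at h
  rw [show (absoluteGaloisGroup.toAlgEquiv ℚ_[p] τ) (ι ζ) =
      (show AlgebraicClosure ℚ_[p] ≃ₐ[ℚ_[p]] AlgebraicClosure ℚ_[p] from τ) (ι ζ) from rfl]
  exact h.symm

variable [(galRange (K := K) K₀).Normal]

/-- **The local index bound**: `[Γ_{ℚ_p} : (towerSubgroup κ K₀ n)_{ℚ_p}]` divides
`[Γ_K : Gal(K̄/K₀·K_n^κ)] ≤ pⁿ · [Γ_K : Gal(K̄/K₀)]`. [cite: SerreGaloisCohomology1997, II.§1.1] -/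
theorem index_localSubgroupOfEmb_towerSubgroup_le (n : ℕ) :
    (localSubgroupOfEmb (towerSubgroup κ K₀ n) ι).index ≤ p ^ n * (galRange (K := K) K₀).index ∧
      (localSubgroupOfEmb (towerSubgroup κ K₀ n) ι).index ≠ 0 := by
  have hdvd := index_localSubgroupOfEmb_dvd ι (towerSubgroup κ K₀ n)
  have hne : (towerSubgroup κ K₀ n).index ≠ 0 := Subgroup.FiniteIndex.index_ne_zero
  refine ⟨(Nat.le_of_dvd (Nat.pos_of_ne_zero hne) hdvd).trans ?_, fun h0 => hne (Nat.eq_zero_of_zero_dvd (h0 ▸ hdvd))⟩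
  have h := Subgroup.index_inf_le (H := κ.layerSubgroup n) (K := galRange (K := K) K₀)
  rw [κ.index_layerSubgroup n] at h
  exact h

variable {κ} in
/-- **F9 — `(towerSubgroup κ K₀ n)_{ℚ_p} = Stab(ζ_{p^{n+1}})`, i.e. `K_{n,v} = ℚ_p(ζ_{p^{n+1}})`.** For `κ`
cyclotomic, `K₀ ⊇ μ_p` with `[Γ_K : Gal(K̄/K₀)] ≤ p − 1` (Kobayashi: `K = ℚ`, `K₀ = ℚ(μ_p)`), `p` odd:
the inclusion of §3 plus the index count `[Γ_{ℚ_p} : (·)_{ℚ_p}] ≤ pⁿ(p − 1) = φ(p^{n+1}) =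
[Γ_{ℚ_p} : Stab(ζ_{p^{n+1}})]` force equality. This is the hypothesis `hU` of
`localFixedPointsOfEmb_le_sup_towerSigned` (file KobayashiSignedGenerationDischarge) for cc-typer-6's
tower `towerSubgroup κ K₀`. [cite: Kobayashi2003, §2 p. 4 (k_n = ℚ_p(ζ_{p^{n+1}}), K_n/ℚ totally ramified at p)]
[cite: SerreLocalFields1979, Ch. IV §4] -/
theorem localSubgroupOfEmb_towerSubgroup_eq_stab (hp2 : p ≠ 2) (hκ : κ.IsCyclotomic)
    (hz : ∃ z : K₀, IsPrimitiveRoot z p) (hidx : (galRange (K := K) K₀).index ≤ p - 1) (n : ℕ) :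
    localSubgroupOfEmb (towerSubgroup κ K₀ n) ι = stab p (n + 1) := by
  have hidx0 : (galRange (K := K) K₀).index ≠ 0 := Subgroup.FiniteIndex.index_ne_zero
  have hndvd : ¬ p ∣ (galRange (K := K) K₀).index := fun h =>
    absurd (Nat.le_of_dvd (Nat.pos_of_ne_zero hidx0) h) (by have := hp.out.one_lt; omega)
  have hle := localSubgroupOfEmb_towerSubgroup_le_stab K₀ ι hp2 hκ hz hndvd n
  obtain ⟨hbound, hne⟩ := index_localSubgroupOfEmb_towerSubgroup_le κ K₀ ι n
  set A := localSubgroupOfEmb (towerSubgroup κ K₀ n) ι with hA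
  have hB : (stab p (n + 1)).index = p ^ n * (p - 1) := by
    rw [index_stab', Nat.totient_prime_pow_succ hp.out]
  -- `B.index ∣ A.index ≤ B.index`
  have hdvd : (stab p (n + 1)).index ∣ A.index := Subgroup.index_dvd_of_le hle
  have hAB : A.index ≤ (stab p (n + 1)).index := by
    rw [hB]; exact hbound.trans (Nat.mul_le_mul_left _ hidx)
  have heq : A.index = (stab p (n + 1)).index :=
    le_antisymm hAB (Nat.le_of_dvd (Nat.pos_of_ne_zero hne) hdvd)
  have hB0 : (stab p (n + 1)).index ≠ 0 := by rw [← heq]; exact hne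
  have hrel : A.relIndex (stab p (n + 1)) = 1 := by
    have h := Subgroup.relIndex_mul_index hle
    rw [heq] at h
    exact (mul_eq_right₀ hB0).mp h
  exact le_antisymm hle (Subgroup.relIndex_eq_one.mp hrel)

variable {κ} in
/-- **F9, degree form**: `K₀/K` Galois of degree `≤ p − 1` containing a primitive `p`-th root of unity
(Kobayashi: `K₀ = ℚ(μ_p)`, degree `p − 1`), `κ` cyclotomic, `p` odd ⟹
`(towerSubgroup κ K₀ n)_{ℚ_p} = Stab(ζ_{p^{n+1}})` for every `n` (`RelModel.index_galRange`).
[cite: Kobayashi2003, §2 p. 4] -/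
theorem localSubgroupOfEmb_towerSubgroup_eq_stab_of_finrank_le [IsGalois K K₀] (hp2 : p ≠ 2)
    (hκ : κ.IsCyclotomic) (hz : ∃ z : K₀, IsPrimitiveRoot z p) (hK₀ : Module.finrank K K₀ ≤ p - 1) (n : ℕ) :
    localSubgroupOfEmb (towerSubgroup κ K₀ n) ι = stab p (n + 1) :=
  localSubgroupOfEmb_towerSubgroup_eq_stab K₀ ι hp2 hκ hz (by rw [RelModel.index_galRange (K := K) K₀]; exact hK₀) n

end Local

end Summit.BirchSwinnertonDyer.Rank1Residual.Additive

end
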